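import Literature.MathematicalPhysics.QuantumFieldTheory.BalabanImbrieJaffe1984to88.BIJ88Ineq5144EndChainDecay
import Literature.Analysis.OperatorTheory.CombesThomasBanded

/-!
# `BalabanImbrieJaffe1984to88.BIJ88Ineq5144EndChainCT` — T. Bałaban, J. Imbrie, A. Jaffe, *Effective action and cluster properties of the abelian
Higgs model*, Commun. Math. Phys. **114** (1988) 257–315 [BalabanImbrieJaffe1988], Sect. 5.13 p. 305 [PDF 49] (*"Using the theorem on unit lattice
operators in [6], we can invert this operator to yield an exponentially decaying covariance C_s = (−Δ_s)⁻¹."*, p0049 L17–18) and p. 307 [PDF 51],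
with Sect. 5.14 (5.14.4) p. 309 [PDF 53] and [CombesThomas1973] §II: **THE DECAY LETTER (b) OF THE END-CHAIN INSTANCE DERIVED FROM LETTERS ON `Δ`
BY THE COMBES–THOMAS ESTIMATE** — the one analytic INPUT of `BIJ88Ineq5144EndChainDecay.ineq5144_locAct_endChain_of_decay` (the pointwise decay of
the RESTRICTED interpolated inverses `((Δ_{1_{Λ′}})_s↾Λ)⁻¹`, uniform in `s` and in the conditioning geometry) becomes a CONSEQUENCE of print's
p. 305 hypotheses on `Δ` as a unit-lattice operator: `Δ ≥ m·1`, finite range (`Δ_{xy} = 0` beyond lattice distance `1` for a site pseudo-distance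
`d`), bounded couplings `|Δ_{xy}| ≤ h`, at most `z` neighbours per site.  Mechanism: restriction to `Λ` and the interpolations `1_{Λ′}`, `s` only
DELETE or SHRINK off-diagonal entries and keep the form bound `≥ m·1` (p. 305 *"convex combinations"*), so every `((Δ_{1_{Λ′}})_s↾Λ)` is again a
banded unit-lattice operator with the SAME constants, and the tree's finite-dimensional Combes–Thomas estimate
(`Literature.Analysis.OperatorTheory.combesThomas_banded`) gives `|((Δ_{1_{Λ′}})_s↾Λ)⁻¹(x,l)| ≤ (2/m)·e^{−μ d(x,l)}` for every rate `μ ≥ 0` with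
`h z (e^μ − 1) ≤ m/2` — uniformly in `s`, `Λ′`, `Λ` and the volume (`restricted_inv_decay`).  With the cube side `ℓ` (print's `r(e_k)`, in lattice
units) this is letter (b) with `c₁ = 2/m`, `δ = e^{−μℓ}` and `d(x,l)` measured in cube sides (`restricted_inv_decay_pow`), and the instance becomes
**`ineq5144_locAct_endChain_of_combesThomas`**: (5.14.4) located on the sourceless end-decorated three-cube chain from `Δ`-letters only (form
bound, range, coupling size, neighbour count), the lattice geometry of the chain (the `□_n`-face and the `□_a`-face of `□_b` are `≥ ℓ` apart),
W, R, clause (ii), the vacuum clause and the regime clause `4W³R³(2/m)²e^{−2μℓ} ≤ m·θ^{β′}` (print: `e^{−cr(e_k)}` beats every power of `e_k`).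

statement-level skeleton of published theorems with citation tags; proofs where landed; nothing here is a claim about the Yang–Mills mass gap

PDF held: `paper:balaban1988-cmp114-bij-abelian-higgs-effective-action` (journal page = PDF page + 256); p. 305 (p0049 L17–18) as quoted.

WHAT IS PROVED (unit `lit-balaban-p36`, generation 19 of the Phase-2 proof seat p36; SKELETON rows C2.Eq5.14.3-5.14.4 (flip item) /
C2.Eq5.13.3-5.13.4 of `HOME/lit-balaban-r16/ROWS-C2-part2.md`, owner r16; 0 definitions, 0 `Prop` facts, theorems only).
* §1 `dotProduct_glue_zero`, `blkIn_form_ge` (restriction keeps the form bound), `mulVec_inv_col` (the columns of `B⁻¹` solve `Bv = e_l`),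
  **`restricted_inv_decay`** (Combes–Thomas for every restricted interpolated precision), `restricted_inv_decay_pow` (the same in cube-side units).
* §2 **`ineq5144_locAct_endChain_of_combesThomas`** — the instance with (b) derived.
HONEST SCOPE: the class and the other clauses of `BIJ88Ineq5144EndChainDecay` are unchanged (sourceless, end-decorated, three cubes); what is new is
only that the decay letter is no longer an input.  Imports `BIJ88Ineq5144EndChainDecay` (p36 g19) and `Literature.Analysis.OperatorTheory.
CombesThomasBanded` (Mathlib-only leaf); modifies nothing.  NOT summit progress; NOT continuum; NOT Clay.  Cell `lit-balaban` Phase 2, seat p36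
gen 19 (owner r16, referee ref-5).
-/

noncomputable section

open Finset MeasureTheory Matrix Function Filter
open Literature.MathematicalPhysics.QuantumFieldTheory.Balaban1983to89
open Literature.MathematicalPhysics.QuantumFieldTheory.BalabanImbrieJaffe1984to88
open B2Eq228Conditioning (In Out resIn resOut glue blkIn blkMix condShift glue_apply_in glue_apply_out quadForm_glue sum_split)
open BIJ88Sect5Statements (CutoffProfile)
open BIJ88DirichletForms305 (interpForm interpForm_apply interpForm_posDef quadForm_interpForm_ge)
open BIJ88PolymerRep5134 (corner)
open BIJ88PolymerRep5134GaussWitness (corner_mem_cube)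
open BIJ88Eq5145CornerModel (slotB slotY)
open BIJ88Eq5145CornerUrsell (cubeIn)
open BIJ88W6PrimeVsupp (actIn)
open BIJ88Ineq5144Located (locAct)
open BIJ88EndChainFluct309 (abs_interpForm_apply_le interpForm_apply_eq_zero)
open BIJ88Ineq5144EndChainDecay (ineq5144_locAct_endChain_of_decay)
open Literature.Analysis.OperatorTheory (combesThomas_banded)

namespace Literature.MathematicalPhysics.QuantumFieldTheory.BalabanImbrieJaffe1984to88.BIJ88Ineq5144EndChainCT

variable {α I : Type} [Fintype α] [DecidableEq α] [Fintype I] [DecidableEq I] (blk : α → I) (Δ : Matrix α α ℝ)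

/-! ## §1 Combes–Thomas for the restricted interpolated precisions -/

section CT

variable {Δ}

omit [DecidableEq α] [Fintype I] [DecidableEq I] in
/-- `‖(x on Λ, 0 on Λᶜ)‖² = ‖x‖²`. [folklore] [cite: Balaban1982Higgs2, (2.28) p.563] -/
theorem dotProduct_glue_zero (P : α → Prop) [DecidablePred P] (x : In P → ℝ) : glue P x 0 ⬝ᵥ glue P x 0 = x ⬝ᵥ x := by
  rw [dotProduct, sum_split P]
  simp only [glue_apply_in, glue_apply_out, Pi.zero_apply, mul_zero, sum_const_zero, add_zero]
  rfl

omit [DecidableEq α] [Fintype I] [DecidableEq I] in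
/-- **restriction keeps the form bound**: `A ≥ m·1 ⇒ A_Λ ≥ m·1`. [folklore] [cite: BalabanImbrieJaffe1988, §5.13 p.305] -/
theorem blkIn_form_ge (P : α → Prop) [DecidablePred P] {A : Matrix α α ℝ} {m : ℝ} (hA : ∀ v : α → ℝ, m * (v ⬝ᵥ v) ≤ v ⬝ᵥ (A *ᵥ v))
    (x : In P → ℝ) : m * (x ⬝ᵥ x) ≤ x ⬝ᵥ (blkIn P A *ᵥ x) := by
  have h := hA (glue P x 0)
  rw [quadForm_glue, dotProduct_glue_zero] at h
  simpa [mulVec_zero, dotProduct_zero, zero_dotProduct] using h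

omit [Fintype I] [DecidableEq I] in
/-- the `l`-th column of `B⁻¹` solves `Bv = e_l` for an invertible `B`. [folklore] [cite: CombesThomas1973, §II] -/
theorem mulVec_inv_col {β : Type} [Fintype β] [DecidableEq β] (B : Matrix β β ℝ) (hB : IsUnit B.det) (l : β) :
    B *ᵥ (fun i => B⁻¹ i l) = Pi.single l 1 := by
  funext j
  have h : (B * B⁻¹) j l = (1 : Matrix β β ℝ) j l := by rw [mul_nonsing_inv _ hB]
  rw [Matrix.mul_apply, Matrix.one_apply] at h
  rw [mulVec, dotProduct, Pi.single_apply]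
  exact h

/-- **COMBES–THOMAS FOR THE RESTRICTED INTERPOLATED PRECISIONS** (p. 305: the interpolated forms are again unit-lattice operators with the same
bottom and range, hence have exponentially decaying inverses): if `Δ ≥ m·1` (`m > 0`), `Δ_{xy} = 0` for `d(x,y) > 1` (`d` a symmetric
pseudo-distance with the triangle inequality), `|Δ_{xy}| ≤ h` off the diagonal, every site has `≤ z` others within distance `1`, and `μ ≥ 0`
satisfies `h z (e^μ − 1) ≤ m/2`, then for every corner `Λ′`, every `s ∈ [0,1]^I`, every site set `Λ = {x | P x}` and all `x, l ∈ Λ`,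
`|((Δ_{1_{Λ′}})_s↾Λ)⁻¹(x,l)| ≤ (2/m)·e^{−μ d(x,l)}`. [cite: BalabanImbrieJaffe1988, §5.13 p.305; p.307] [cite: CombesThomas1973, §II] -/
theorem restricted_inv_decay (d : α → α → ℝ) (hd0 : ∀ i, d i i = 0) (hdsymm : ∀ i k, d i k = d k i) (hdtri : ∀ i j k, d i k ≤ d i j + d j k)
    (hband : ∀ x y, 1 < d x y → Δ x y = 0) {h : ℝ} (hh0 : 0 ≤ h) (hh : ∀ x y, x ≠ y → |Δ x y| ≤ h)
    {z : ℝ} (hz : ∀ x, ((univ.filter fun y => y ≠ x ∧ d x y ≤ 1).card : ℝ) ≤ z)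
    (hΔ : Δ.PosDef) {m : ℝ} (hm : 0 < m) (hΔm : ∀ φ : α → ℝ, m * (φ ⬝ᵥ φ) ≤ φ ⬝ᵥ (Δ *ᵥ φ))
    {μ : ℝ} (hμ : 0 ≤ μ) (hsmall : h * z * (Real.exp μ - 1) ≤ m / 2)
    (Λc : Finset I) {s : I → ℝ} (hs : ∀ l, 0 ≤ s l ∧ s l ≤ 1) (P : α → Prop) [DecidablePred P] (x l : In P) :
    |(blkIn P (interpForm blk (interpForm blk Δ (corner ℝ Λc)) s))⁻¹ x l| ≤ 2 / m * Real.exp (-(μ * d x.1 l.1)) := by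
  have hcs := corner_mem_cube (I := I) Λc
  have hΔc : (interpForm blk Δ (corner ℝ Λc)).PosDef := interpForm_posDef blk hΔ hcs
  have hA : (interpForm blk (interpForm blk Δ (corner ℝ Λc)) s).PosDef := interpForm_posDef blk hΔc hs
  have hmA : ∀ v : α → ℝ, m * (v ⬝ᵥ v) ≤ v ⬝ᵥ (interpForm blk (interpForm blk Δ (corner ℝ Λc)) s *ᵥ v) :=
    quadForm_interpForm_ge blk (quadForm_interpForm_ge blk hΔm hcs) hs
  have hB : (blkIn P (interpForm blk (interpForm blk Δ (corner ℝ Λc)) s)).PosDef := by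
    unfold blkIn; exact hA.submatrix Subtype.val_injective
  -- the entries of the restricted interpolated precision are dominated by those of `Δ`
  have hent : ∀ i k : In P, |blkIn P (interpForm blk (interpForm blk Δ (corner ℝ Λc)) s) i k| ≤ |Δ i.1 k.1| := fun i k =>
    (abs_interpForm_apply_le blk _ hs _ _).trans (abs_interpForm_apply_le blk Δ hcs _ _)
  refine combesThomas_banded (blkIn P (interpForm blk (interpForm blk Δ (corner ℝ Λc)) s)) (fun i k => d i.1 k.1) m h z μ hm hμ
    (fun i => hd0 i.1) (fun i k => hdsymm i.1 k.1) (fun i j k => hdtri i.1 j.1 k.1) (fun i k hik => ?_) hh0 (fun i k hik => ?_)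
    (fun i => ?_) (blkIn_form_ge P hmA) hsmall l (fun i => (blkIn P (interpForm blk (interpForm blk Δ (corner ℝ Λc)) s))⁻¹ i l)
    (mulVec_inv_col _ (isUnit_iff_ne_zero.2 hB.det_pos.ne') l) x
  · -- banded
    have h0 : Δ i.1 k.1 = 0 := hband _ _ hik
    have := hent i k
    rw [h0, abs_zero] at this
    exact abs_eq_zero.1 (le_antisymm this (abs_nonneg _))
  · -- off-diagonal entries
    exact (hent i k).trans (hh _ _ fun h' => hik (Subtype.ext h'))
  · -- neighbour count
    have hc : ((univ : Finset (In P)).filter fun k => k ≠ i ∧ d i.1 k.1 ≤ 1).card ≤ (univ.filter fun y => y ≠ i.1 ∧ d i.1 y ≤ 1).card :=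
      card_le_card_of_injOn (fun k => k.1)
        (fun k hk => by
          simp only [coe_filter, mem_univ, true_and, Set.mem_setOf_eq] at hk ⊢
          exact ⟨fun h' => hk.1 (Subtype.ext h'), hk.2⟩)
        (fun k₁ _ k₂ _ h' => Subtype.ext h')
    exact le_trans (by exact_mod_cast hc) (hz i.1)

/-- the same decay in units of the cube side `ℓ` (lattice units): `|((Δ_{1_{Λ′}})_s↾Λ)⁻¹(x,l)| ≤ (2/m)·(e^{−μℓ})^{⌊d(x,l)/ℓ⌋}` — letter (b) of
`BIJ88Ineq5144EndChainDecay` with `c₁ = 2/m`, `δ = e^{−μℓ}`, `ds = ⌊d/ℓ⌋`. [cite: BalabanImbrieJaffe1988, §5.13 p.305; p.307] -/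
theorem restricted_inv_decay_pow (d : α → α → ℝ) (hd0 : ∀ i, d i i = 0) (hdsymm : ∀ i k, d i k = d k i)
    (hdtri : ∀ i j k, d i k ≤ d i j + d j k) (hband : ∀ x y, 1 < d x y → Δ x y = 0) {h : ℝ} (hh0 : 0 ≤ h)
    (hh : ∀ x y, x ≠ y → |Δ x y| ≤ h) {z : ℝ} (hz : ∀ x, ((univ.filter fun y => y ≠ x ∧ d x y ≤ 1).card : ℝ) ≤ z)
    (hΔ : Δ.PosDef) {m : ℝ} (hm : 0 < m) (hΔm : ∀ φ : α → ℝ, m * (φ ⬝ᵥ φ) ≤ φ ⬝ᵥ (Δ *ᵥ φ))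
    {μ : ℝ} (hμ : 0 ≤ μ) (hsmall : h * z * (Real.exp μ - 1) ≤ m / 2) {ℓ : ℝ} (hℓ : 0 < ℓ)
    (Λc : Finset I) {s : I → ℝ} (hs : ∀ l, 0 ≤ s l ∧ s l ≤ 1) (P : α → Prop) [DecidablePred P] (x l : In P) :
    |(blkIn P (interpForm blk (interpForm blk Δ (corner ℝ Λc)) s))⁻¹ x l| ≤
      2 / m * Real.exp (-(μ * ℓ)) ^ ⌊d x.1 l.1 / ℓ⌋₊ := by
  refine (restricted_inv_decay blk d hd0 hdsymm hdtri hband hh0 hh hz hΔ hm hΔm hμ hsmall Λc hs P x l).trans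
    (mul_le_mul_of_nonneg_left ?_ (div_nonneg (by norm_num) hm.le))
  have hdnn : 0 ≤ d x.1 l.1 := by
    have h1 := hdtri x.1 l.1 x.1
    rw [hd0, hdsymm l.1 x.1] at h1
    linarith
  rw [← Real.exp_nat_mul, Real.exp_le_exp]
  have hfl : (⌊d x.1 l.1 / ℓ⌋₊ : ℝ) * ℓ ≤ d x.1 l.1 := by
    have := Nat.floor_le (div_nonneg hdnn hℓ.le)
    rwa [le_div_iff₀ hℓ] at this
  nlinarith

end CT

/-! ## §2 The end-chain instance with the decay letter derived -/

section Main

variable (ℱ : α → ℝ) (adj : I → I → Prop) [DecidableRel adj]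
variable (χ : CutoffProfile) {ι υ : Type} [DecidableEq ι] [DecidableEq υ]
variable (p ek : ℝ) (B : Finset ι) (Φ : ι → (α → ℝ) → ℝ) (c : ι → ℝ) (Ys : Finset υ) (V : υ → (α → ℝ) → ℝ)
variable (cube : ↥B ⊕ ↥Ys → I)

/-- **(5.14.4) LOCATED ON THE END-DECORATED THREE-CUBE CHAIN, THE DECAY DERIVED FROM `Δ`-LETTERS** — `BIJ88Ineq5144EndChainDecay.
ineq5144_locAct_endChain_of_decay` with its decay letter (b), its constants `c₁, δ`, its site separation `ds` and its chain-geometry clause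
REPLACED by: a site pseudo-distance `d` (lattice units), `Δ` of range `1` in `d` with couplings `|Δ_{xy}| ≤ h` and `≤ z` neighbours per site, a
Combes–Thomas rate `μ ≥ 0` with `h z(e^μ − 1) ≤ m/2`, the cube side `ℓ > 0` with the `□_n`-face and the `□_a`-face of `□_b` at distance `≥ ℓ`
(print's cubes of side `r(e_k)`), and the regime clause `4W³R³(2/m)²(e^{−μℓ})² ≤ m·θ^{β′}`; all other binders verbatim.
[cite: BalabanImbrieJaffe1988, (5.14.4) p.309; §5.13 p.305, p.307] [cite: CombesThomas1973, §II] -/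
theorem ineq5144_locAct_endChain_of_combesThomas [Fintype ι] [Fintype υ]
    (hΔ : Δ.PosDef) {m : ℝ} (hm : 0 < m) (hΔm : ∀ φ : α → ℝ, m * (φ ⬝ᵥ φ) ≤ φ ⬝ᵥ (Δ *ᵥ φ))
    (hΦloc : ∀ b : B, ∀ φ ψ : α → ℝ, (∀ x, blk x = cube (Sum.inl b) → φ x = ψ x) → Φ b φ = Φ b ψ)
    (hVloc : ∀ Y : Ys, ∀ φ ψ : α → ℝ, (∀ x, blk x = cube (Sum.inr Y) → φ x = ψ x) → V Y φ = V Y ψ)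
    (hV : ∀ Y ∈ Ys, Measurable (V Y)) {KY : υ → ℝ} (hK : ∀ Y ∈ Ys, ∀ φ, |V Y φ| ≤ KY Y)
    {K₁ : ℝ} (hK₁0 : 0 ≤ K₁) (hK₁ : ∀ Y ∈ Ys, KY Y ≤ K₁) {G : ℕ} (hG : ∀ i, (univ.filter fun τ : ↥B ⊕ ↥Ys => cube τ = i).card ≤ G)
    {θ β' : ℝ} (hθ0 : 0 < θ) (hθ1 : θ ≤ 1) (hβ : 0 ≤ β')
    (hvac : Real.exp (2 * G * K₁) - 1 ≤ θ ^ (2 * β') / 2) (hKθ₂ : ∀ Y ∈ Ys, KY Y * Real.exp (2 * G * K₁) ≤ θ ^ (1 + β') / 2)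
    {W : ℕ} (hW : ∀ i, (univ.filter fun x : α => blk x = i).card ≤ W)
    {R : ℝ} (hR0 : 0 ≤ R) (hR : ∀ x, ∑ y ∈ univ.filter (fun y => blk y ≠ blk x), |Δ x y| ≤ R)
    (hℱ : ℱ = 0) {a b n : I} (hab : a ≠ b) (han : a ≠ n) (hbn : b ≠ n) (haV : ∀ b' : ↥B, cube (Sum.inl b') ≠ a)
    (hbfree : ∀ τ : ↥B ⊕ ↥Ys, cube τ ≠ b) (hnfree : ∀ τ : ↥B ⊕ ↥Ys, cube τ ≠ n) (hfar : ∀ x y, blk x = n → blk y = a → Δ x y = 0)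
    -- the `Δ`-letters replacing the decay letter: range, coupling size, neighbour count, Combes–Thomas rate, cube side, face distance
    (d : α → α → ℝ) (hd0 : ∀ i, d i i = 0) (hdsymm : ∀ i k, d i k = d k i) (hdtri : ∀ i j k, d i k ≤ d i j + d j k)
    (hband : ∀ x y, 1 < d x y → Δ x y = 0) {h : ℝ} (hh0 : 0 ≤ h) (hh : ∀ x y, x ≠ y → |Δ x y| ≤ h)
    {z : ℝ} (hz : ∀ x, ((univ.filter fun y => y ≠ x ∧ d x y ≤ 1).card : ℝ) ≤ z)
    {μ : ℝ} (hμ : 0 ≤ μ) (hsmall : h * z * (Real.exp μ - 1) ≤ m / 2) {ℓ : ℝ} (hℓ : 0 < ℓ)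
    (hface : ∀ x l, (blk x = n ∨ (blk x = b ∧ ∃ y, blk y = n ∧ Δ y x ≠ 0)) → blk l = b → (∃ k, blk k = a ∧ Δ l k ≠ 0) → ℓ ≤ d x l)
    (Λc X : Finset I) (hreg : 4 * ((W : ℝ) ^ 3 * R ^ 3 * (2 / m) ^ 2 * Real.exp (-(μ * ℓ)) ^ 2) ≤ m * θ ^ β')
    {t : ℝ} (ht0 : 0 ≤ t) (ht1 : t ≤ 1) {L : Type} [DecidableEq L] (γ : L → ↥(slotB B Ys cube X) ⊕ ↥(slotY B Ys cube X)) (H : Finset L) :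
    |locAct (cubeIn cube X ∘ γ) (actIn blk Δ ℱ adj χ p ek B Φ c Ys V cube Λc X t γ) H ({a, b, n} : Finset I)| ≤
      θ ^ ((H.card : ℝ) + β' * ((({a, b, n} : Finset I) \ H.image (cubeIn cube X ∘ γ)).card : ℝ)) := by
  have hdnn : ∀ x y, 0 ≤ d x y := fun x y => by
    have h1 := hdtri x y x
    rw [hd0, hdsymm y x] at h1
    linarith
  exact ineq5144_locAct_endChain_of_decay blk Δ ℱ adj χ p ek B Φ c Ys V cube hΔ hm hΔm hΦloc hVloc hV hK hK₁0 hK₁ hG hθ0 hθ1 hβ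
    hvac hKθ₂ hW hR0 hR hℱ hab han hbn haV hbfree hnfree hfar (fun x l => ⌊d x l / ℓ⌋₊) (div_nonneg (by norm_num) hm.le)
    (Real.exp_pos _).le (Real.exp_le_one_iff.2 (neg_nonpos.2 (mul_nonneg hμ hℓ.le)))
    (fun x l hx hl hk => (Nat.le_floor_iff (div_nonneg (hdnn x l) hℓ.le)).2
      (by rw [Nat.cast_one, le_div_iff₀ hℓ, one_mul]; exact hface x l hx hl hk))
    Λc X (fun s hs _ x l => restricted_inv_decay_pow blk d hd0 hdsymm hdtri hband hh0 hh hz hΔ hm hΔm hμ hsmall hℓ Λc hs _ x l)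
    hreg ht0 ht1 γ H

end Main

end Literature.MathematicalPhysics.QuantumFieldTheory.BalabanImbrieJaffe1984to88.BIJ88Ineq5144EndChainCT

end
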